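import Literature.Analysis.Calculus.HardyExterior
import Mathlib.Analysis.Calculus.Deriv.Inv
import Mathlib.Analysis.Calculus.BumpFunction.FiniteDimension
import HarnessLib

/-!
# The weighted Hardy inequality on `ℝ³` with the "good derivative" `u + Du(y)[y]` and a signed
# layer term: `½∫ w u²/|y|² − ∫ (Dw(y)[y]) u²/|y|² ≤ 2∫ w (u + Du(y)[y])²/|y|²`

(namespace `Literature.Analysis.Calculus`; companion of `HardyExterior.lean`)

For a nonnegative `C¹` weight `w` of compact support not containing the origin and a function `u`
of class `C¹` near `tsupport w`, the Euler identity `∫ DΘ(y)[y] dy = −3 ∫ Θ`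
(`integral_fderiv_apply_self_eq`) for `Θ = w u²/|y|²` reads
`∫ w u²/|y|² − ∫ (Dw(y)[y]) u²/|y|² = 2 ∫ w u (u + Du(y)[y]) /|y|²`, whence, by `2ab ≤ ½a² + 2b²`,

* `hardy_weighted_goodDeriv_le` —
  `½ ∫ w u²/|y|² − ∫ (Dw(y)[y]) u²/|y|² ≤ 2 ∫ w (u + Du(y)[y])²/|y|²`.

Along the ray `y = ρθ`, `u + Du(y)[y] = ∂_ρ(ρ u)` and `−Dw(y)[y] = −ρ ∂_ρ w`: this is the
three-dimensional form of the weighted interval Hardy inequality of `RadialHardyTwoEdge.lean`, the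
layer term `−∫ (ρ∂_ρ w) u²/ρ²` playing the role of the edge terms (favourable where `w` decreases
outwards). It is the form used on the hyperboloidal leaves cut off smoothly in time — the
(HardyHyperboloid) step of Moschidis, arXiv:1509.08489, proof of Lemma 4.5, and of
Dafermos–Rodnianski–Shlapentokh-Rothman, arXiv:1402.7034, §4.3. No definitions, no named facts.

## References

* G. Moschidis, arXiv:1509.08489, proof of Lemma 4.5 (key `Moschidis2016`).
* M. Dafermos, I. Rodnianski, Y. Shlapentokh-Rothman, arXiv:1402.7034, §4.3
  (key `DafermosRodnianskiShlapentokhrothman2014`).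
-/

noncomputable section

open MeasureTheory Set Filter Module
open scoped Topology RealInnerProductSpace

namespace Literature.Analysis.Calculus

variable {E : Type*} [NormedAddCommGroup E] [InnerProductSpace ℝ E] [FiniteDimensional ℝ E]
  [MeasurableSpace E] [BorelSpace E]

omit [FiniteDimensional ℝ E] [MeasurableSpace E] [BorelSpace E] in
/-- A `C¹` function times a function `C¹` near its support is `C¹`. [folklore] -/
theorem contDiff_mul_of_tsupport_subset_of_contDiffAt {f g : E → ℝ} {U : Set E}
    (hfU : tsupport f ⊆ U) (hf : ContDiff ℝ 1 f) (hg : ∀ x ∈ U, ContDiffAt ℝ 1 g x) :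
    ContDiff ℝ 1 fun x ↦ f x * g x := by
  refine contDiff_iff_contDiffAt.2 fun x ↦ ?_
  by_cases hx : x ∈ U
  · exact hf.contDiffAt.mul (hg x hx)
  · have hx' : x ∉ tsupport f := fun h ↦ hx (hfU h)
    have hev : (fun y ↦ f y * g y) =ᶠ[𝓝 x] fun _ ↦ 0 := by
      filter_upwards [notMem_tsupport_iff_eventuallyEq.mp hx'] with y hy
      simp [hy]
    exact (contDiffAt_const (c := (0 : ℝ))).congr_of_eventuallyEq hev

omit [InnerProductSpace ℝ E] [FiniteDimensional ℝ E] [MeasurableSpace E] [BorelSpace E] in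
/-- A continuous function times a function continuous near its support is continuous. [folklore] -/
theorem continuous_mul_of_tsupport_subset_of_continuousAt {f g : E → ℝ} {U : Set E}
    (hfU : tsupport f ⊆ U) (hf : Continuous f) (hg : ∀ x ∈ U, ContinuousAt g x) :
    Continuous fun x ↦ f x * g x := by
  refine continuous_iff_continuousAt.2 fun x ↦ ?_
  by_cases hx : x ∈ U
  · exact hf.continuousAt.mul (hg x hx)
  · have hx' : x ∉ tsupport f := fun h ↦ hx (hfU h)
    have hev : (fun y ↦ f y * g y) =ᶠ[𝓝 x] fun _ ↦ 0 := by
      filter_upwards [notMem_tsupport_iff_eventuallyEq.mp hx'] with y hy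
      simp [hy]
    exact continuousAt_const.congr_of_eventuallyEq hev

/-- **Weighted Hardy inequality with the good derivative and a signed layer term** (`dim E = 3`).
Let `w ∈ C¹_c(E)`, `w ≥ 0`, `0 ∉ tsupport w`, and `u` of class `C¹` at every point of `tsupport w`.
Then `½ ∫ w u²/‖y‖² − ∫ (Dw(y)[y]) u²/‖y‖² ≤ 2 ∫ w (u + Du(y)[y])²/‖y‖²`.
Moschidis arXiv:1509.08489, proof of Lemma 4.5, (HardyHyperboloid); DRSR arXiv:1402.7034, §4.3.
[cite: Moschidis2016, Lemma 4.5 (proof)] -/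
theorem hardy_weighted_goodDeriv_le (h3 : finrank ℝ E = 3) {u w : E → ℝ} (hw : ContDiff ℝ 1 w)
    (hwc : HasCompactSupport w) (hw0 : ∀ y, 0 ≤ w y) (h0 : (0 : E) ∉ tsupport w)
    (hu : ∀ y ∈ tsupport w, ContDiffAt ℝ 1 u y) :
    (1 / 2) * (∫ y, w y * u y ^ 2 / ‖y‖ ^ 2) - ∫ y, fderiv ℝ w y y * u y ^ 2 / ‖y‖ ^ 2 ≤
      2 * ∫ y, w y * (u y + fderiv ℝ u y y) ^ 2 / ‖y‖ ^ 2 := by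
  have hne : ∀ y ∈ tsupport w, (y : E) ≠ 0 := fun y hy h ↦ h0 (h ▸ hy)
  have hK : IsCompact (tsupport w) := hwc
  have hwz : ∀ y ∉ tsupport w, w y = 0 := fun y hy ↦ image_eq_zero_of_notMem_tsupport hy
  have hDwz : ∀ y ∉ tsupport w, fderiv ℝ w y = 0 := fun y hy ↦ fderiv_of_notMem_tsupport ℝ hy
  -- `θ = w / ‖y‖²` is `C¹` (the weight vanishes near the origin)
  set θ : E → ℝ := fun y ↦ w y * (‖y‖ ^ 2)⁻¹ with hθ
  have hinvC : ∀ y : E, y ≠ 0 → ContDiffAt ℝ 1 (fun y : E ↦ (‖y‖ ^ 2)⁻¹) y := fun y hy ↦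
    ((contDiff_norm_sq ℝ).contDiffAt).inv (pow_ne_zero 2 (norm_ne_zero_iff.2 hy))
  have hθC : ContDiff ℝ 1 θ :=
    contDiff_mul_of_tsupport_subset_of_contDiffAt (U := tsupport w) subset_rfl hw
      fun y hy ↦ hinvC y (hne y hy)
  have hθz : ∀ y ∉ tsupport w, θ y = 0 := fun y hy ↦ by simp [hθ, hwz y hy]
  have hθsupp : tsupport θ ⊆ tsupport w :=
    closure_minimal (fun y hy ↦ by_contra fun h ↦ hy (hθz y h)) (isClosed_tsupport w)
  have hθnn : ∀ y, 0 ≤ θ y := fun y ↦ mul_nonneg (hw0 y) (inv_nonneg.2 (sq_nonneg _))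
  -- `Dθ(y)[y] = Dw(y)[y]/‖y‖² − 2θ(y)`
  have hN : ∀ y : E, HasFDerivAt (fun y : E ↦ ‖y‖ ^ 2) (2 • innerSL ℝ y) y := fun y ↦
    (hasStrictFDerivAt_norm_sq y).hasFDerivAt
  have hDθ : ∀ y, fderiv ℝ θ y y = fderiv ℝ w y y * (‖y‖ ^ 2)⁻¹ - 2 * θ y := by
    intro y
    by_cases hy : y ∈ tsupport w
    · have hy0 : ‖y‖ ^ 2 ≠ 0 := pow_ne_zero 2 (norm_ne_zero_iff.2 (hne y hy))
      have hρ : ‖y‖ ≠ 0 := norm_ne_zero_iff.2 (hne y hy)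
      have h1 : HasFDerivAt (fun y : E ↦ (‖y‖ ^ 2)⁻¹) ((-((‖y‖ ^ 2) ^ 2)⁻¹) • (2 • innerSL ℝ y)) y :=
        (hasDerivAt_inv hy0).comp_hasFDerivAt y (hN y)
      have h2 : HasFDerivAt θ (w y • ((-((‖y‖ ^ 2) ^ 2)⁻¹) • (2 • innerSL ℝ y)) +
          (‖y‖ ^ 2)⁻¹ • fderiv ℝ w y) y :=
        ((hw.differentiable one_ne_zero y).hasFDerivAt).mul h1
      rw [h2.fderiv]
      simp only [_root_.add_apply, _root_.smul_apply, smul_eq_mul, innerSL_apply_apply,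
        real_inner_self_eq_norm_sq, hθ]
      field_simp
      ring
    · have hθ0 : fderiv ℝ θ y = 0 := fderiv_of_notMem_tsupport ℝ fun h ↦ hy (hθsupp h)
      simp [hθ0, hDwz y hy, hθz y hy]
  -- the test function `Θ = θ u²`
  have hu2 : ∀ y ∈ tsupport w, ContDiffAt ℝ 1 (fun y ↦ u y ^ 2) y := fun y hy ↦ (hu y hy).pow 2
  have hΘC : ContDiff ℝ 1 fun y ↦ θ y * u y ^ 2 :=
    contDiff_mul_of_tsupport_subset_of_contDiffAt hθsupp hθC hu2
  have hΘc : HasCompactSupport fun y ↦ θ y * u y ^ 2 :=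
    HasCompactSupport.intro hK fun y hy ↦ by simp [hθz y hy]
  have hDΘ : ∀ y, fderiv ℝ (fun y ↦ θ y * u y ^ 2) y y =
      (fderiv ℝ w y y * (‖y‖ ^ 2)⁻¹ - 2 * θ y) * u y ^ 2 + 2 * θ y * u y * fderiv ℝ u y y := by
    intro y
    by_cases hy : y ∈ tsupport w
    · have h1 : HasFDerivAt (fun y ↦ u y ^ 2) ((2 * u y) • fderiv ℝ u y) y := by
        have := (((hu y hy).differentiableAt one_ne_zero).hasFDerivAt).pow 2
        simpa using this
      have h2 : HasFDerivAt (fun y ↦ θ y * u y ^ 2)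
          (θ y • ((2 * u y) • fderiv ℝ u y) + u y ^ 2 • fderiv ℝ θ y) y :=
        ((hθC.differentiable one_ne_zero y).hasFDerivAt).mul h1
      rw [h2.fderiv]
      simp only [_root_.add_apply, _root_.smul_apply, smul_eq_mul, hDθ y]
      ring
    · have hz : fderiv ℝ (fun y ↦ θ y * u y ^ 2) y = 0 :=
        fderiv_of_notMem_tsupport ℝ fun h ↦ hy (hθsupp
          ((tsupport_mul_subset_left (f := θ) (g := fun y ↦ u y ^ 2)) h))
      simp [hz, hDwz y hy, hθz y hy]
  -- the Euler identity
  have hEuler := integral_fderiv_apply_self_eq hΘC hΘc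
  rw [h3] at hEuler
  -- continuity and integrability of the pieces (all supported in `tsupport w`)
  have huc : ∀ y ∈ tsupport w, ContinuousAt u y := fun y hy ↦ (hu y hy).continuousAt
  have hDuc : ∀ y ∈ tsupport w, ContinuousAt (fun y ↦ fderiv ℝ u y y) y := fun y hy ↦
    ((hu y hy).continuousAt_fderiv one_ne_zero).clm_apply continuousAt_id
  have hθc : Continuous θ := hθC.continuous
  have hDwc : Continuous fun y ↦ fderiv ℝ w y y * (‖y‖ ^ 2)⁻¹ := by
    refine continuous_mul_of_tsupport_subset_of_continuousAt (U := tsupport w) ?_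
      ((hw.continuous_fderiv one_ne_zero).clm_apply continuous_id) fun y hy ↦
      (hinvC y (hne y hy)).continuousAt
    exact closure_minimal (fun y hy ↦ by_contra fun h ↦ hy (by simp [hDwz y h]))
      (isClosed_tsupport w)
  have hDwsupp : tsupport (fun y ↦ fderiv ℝ w y y * (‖y‖ ^ 2)⁻¹) ⊆ tsupport w :=
    closure_minimal (fun y hy ↦ by_contra fun h ↦ hy (by simp [hDwz y h])) (isClosed_tsupport w)
  have hcs : ∀ {φ : E → ℝ}, (∀ y ∉ tsupport w, φ y = 0) → HasCompactSupport φ :=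
    fun h ↦ HasCompactSupport.intro hK h
  -- I = ∫ θ u², A = ∫ (Dw[y]/ρ²) u², K = ∫ θ u P, J = ∫ θ P²
  have hIc : Continuous fun y ↦ θ y * u y ^ 2 :=
    continuous_mul_of_tsupport_subset_of_continuousAt hθsupp hθc fun y hy ↦ (huc y hy).pow 2
  have hAc : Continuous fun y ↦ fderiv ℝ w y y * (‖y‖ ^ 2)⁻¹ * u y ^ 2 :=
    continuous_mul_of_tsupport_subset_of_continuousAt hDwsupp hDwc fun y hy ↦ (huc y hy).pow 2
  have hKc : Continuous fun y ↦ θ y * (u y * (u y + fderiv ℝ u y y)) :=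
    continuous_mul_of_tsupport_subset_of_continuousAt hθsupp hθc fun y hy ↦
      (huc y hy).mul ((huc y hy).add (hDuc y hy))
  have hJc : Continuous fun y ↦ θ y * (u y + fderiv ℝ u y y) ^ 2 :=
    continuous_mul_of_tsupport_subset_of_continuousAt hθsupp hθc fun y hy ↦
      ((huc y hy).add (hDuc y hy)).pow 2
  have hII : Integrable fun y ↦ θ y * u y ^ 2 :=
    hIc.integrable_of_hasCompactSupport (hcs fun y hy ↦ by simp [hθz y hy])
  have hIA : Integrable fun y ↦ fderiv ℝ w y y * (‖y‖ ^ 2)⁻¹ * u y ^ 2 :=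
    hAc.integrable_of_hasCompactSupport (hcs fun y hy ↦ by simp [hDwz y hy])
  have hIK : Integrable fun y ↦ θ y * (u y * (u y + fderiv ℝ u y y)) :=
    hKc.integrable_of_hasCompactSupport (hcs fun y hy ↦ by simp [hθz y hy])
  have hIJ : Integrable fun y ↦ θ y * (u y + fderiv ℝ u y y) ^ 2 :=
    hJc.integrable_of_hasCompactSupport (hcs fun y hy ↦ by simp [hθz y hy])
  -- the identity `I − A = 2K`
  have hid : (∫ y, θ y * u y ^ 2) - (∫ y, fderiv ℝ w y y * (‖y‖ ^ 2)⁻¹ * u y ^ 2) =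
      2 * ∫ y, θ y * (u y * (u y + fderiv ℝ u y y)) := by
    have e1 : (fun y ↦ fderiv ℝ (fun y ↦ θ y * u y ^ 2) y y) = fun y ↦
        (fderiv ℝ w y y * (‖y‖ ^ 2)⁻¹ * u y ^ 2 - 4 * (θ y * u y ^ 2)) +
          2 * (θ y * (u y * (u y + fderiv ℝ u y y))) := by
      funext y; rw [hDΘ y]; ring
    have e2 : ∫ y, fderiv ℝ (fun y ↦ θ y * u y ^ 2) y y =
        ((∫ y, fderiv ℝ w y y * (‖y‖ ^ 2)⁻¹ * u y ^ 2) - 4 * ∫ y, θ y * u y ^ 2) +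
          2 * ∫ y, θ y * (u y * (u y + fderiv ℝ u y y)) := by
      have i3 : Integrable (fun y ↦ 4 * (θ y * u y ^ 2)) := hII.const_mul 4
      have i1 : Integrable (fun y ↦ fderiv ℝ w y y * (‖y‖ ^ 2)⁻¹ * u y ^ 2 - 4 * (θ y * u y ^ 2)) :=
        hIA.sub i3
      have i2 : Integrable (fun y ↦ 2 * (θ y * (u y * (u y + fderiv ℝ u y y)))) := hIK.const_mul 2
      rw [e1, integral_add i1 i2, integral_sub hIA i3, integral_const_mul, integral_const_mul]
    rw [e2] at hEuler
    norm_num at hEuler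
    linarith
  -- AM–GM: `2 θ u P ≤ ½ θ u² + 2 θ P²`
  have hAM : 2 * (∫ y, θ y * (u y * (u y + fderiv ℝ u y y))) ≤
      (1 / 2) * (∫ y, θ y * u y ^ 2) + 2 * ∫ y, θ y * (u y + fderiv ℝ u y y) ^ 2 := by
    rw [← integral_const_mul, ← integral_const_mul, ← integral_const_mul,
      ← integral_add (hII.const_mul _) (hIJ.const_mul _)]
    refine integral_mono (hIK.const_mul _) ((hII.const_mul _).add (hIJ.const_mul _)) fun y ↦ ?_
    have hθy := hθnn y
    nlinarith [mul_nonneg hθy (sq_nonneg (u y - 2 * (u y + fderiv ℝ u y y)))]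
  -- rewrite the statement in terms of `θ`
  have hI : (∫ y, w y * u y ^ 2 / ‖y‖ ^ 2) = ∫ y, θ y * u y ^ 2 :=
    integral_congr_ae (ae_of_all _ fun y ↦ by simp only [hθ, div_eq_mul_inv]; ring)
  have hA : (∫ y, fderiv ℝ w y y * u y ^ 2 / ‖y‖ ^ 2) =
      ∫ y, fderiv ℝ w y y * (‖y‖ ^ 2)⁻¹ * u y ^ 2 :=
    integral_congr_ae (ae_of_all _ fun y ↦ by simp only [div_eq_mul_inv]; ring)
  have hJ : (∫ y, w y * (u y + fderiv ℝ u y y) ^ 2 / ‖y‖ ^ 2) =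
      ∫ y, θ y * (u y + fderiv ℝ u y y) ^ 2 :=
    integral_congr_ae (ae_of_all _ fun y ↦ by simp only [hθ, div_eq_mul_inv]; ring)
  rw [hI, hA, hJ]
  linarith [hid, hAM]

/-- **The same inequality for `u` vanishing, together with its derivative, at the points of
`tsupport w` outside a ball**, the weight `w ∈ C¹` being arbitrary at infinity (nonnegative, supported away from the origin): reduce
to `hardy_weighted_goodDeriv_le` by multiplying `w` by a smooth bump equal to `1` near the ball,
which changes none of the three integrands. This is the form met on a hyperboloidal leaf cut off
smoothly in time, where the restriction of the wave vanishes far out by finite speed of propagation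
while the weight `χ(T − τ − h(y)) f(y)` need not have compact support. [cite: Moschidis2016, Lemma 4.5 (proof)] -/
theorem hardy_weighted_goodDeriv_le_of_eq_zero (h3 : finrank ℝ E = 3) {u w : E → ℝ}
    (hw : ContDiff ℝ 1 w) (hw0 : ∀ y, 0 ≤ w y) (h0 : (0 : E) ∉ tsupport w)
    (hu : ∀ y ∈ tsupport w, ContDiffAt ℝ 1 u y) {R : ℝ} (hR : 0 < R)
    (huR : ∀ y ∈ tsupport w, R < ‖y‖ → u y = 0)
    (hDuR : ∀ y ∈ tsupport w, R < ‖y‖ → fderiv ℝ u y = 0) :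
    (1 / 2) * (∫ y, w y * u y ^ 2 / ‖y‖ ^ 2) - ∫ y, fderiv ℝ w y y * u y ^ 2 / ‖y‖ ^ 2 ≤
      2 * ∫ y, w y * (u y + fderiv ℝ u y y) ^ 2 / ‖y‖ ^ 2 := by
  have hwz : ∀ y ∉ tsupport w, w y = 0 := fun y hy ↦ image_eq_zero_of_notMem_tsupport hy
  have hDwz : ∀ y ∉ tsupport w, fderiv ℝ w y = 0 := fun y hy ↦ fderiv_of_notMem_tsupport ℝ hy
  -- a bump `χ = 1` on `closedBall 0 (R + 1)`, supported in `ball 0 (R + 2)`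
  let b : ContDiffBump (0 : E) := ⟨R + 1, R + 2, by linarith, by linarith⟩
  set χ : E → ℝ := fun y ↦ b y with hχ
  have hχC : ContDiff ℝ 1 χ := (b.contDiff (n := ⊤)).of_le (by exact_mod_cast le_top)
  have hχ1 : ∀ y : E, ‖y‖ ≤ R + 1 → χ y = 1 := fun y hy ↦
    b.one_of_mem_closedBall (by simpa using hy)
  have hχ0 : ∀ y, 0 ≤ χ y := fun y ↦ b.nonneg
  have hDχ : ∀ y : E, ‖y‖ < R + 1 → fderiv ℝ χ y = 0 := by
    intro y hy
    have hev : χ =ᶠ[𝓝 y] fun _ ↦ 1 := by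
      filter_upwards [Metric.isOpen_ball.mem_nhds (show y ∈ Metric.ball (0 : E) (R + 1) by simpa)]
        with z hz
      exact hχ1 z (le_of_lt (by simpa using hz))
    rw [hev.fderiv_eq]; simp
  -- the modified weight
  set w' : E → ℝ := fun y ↦ χ y * w y with hw'
  have hw'C : ContDiff ℝ 1 w' := hχC.mul hw
  have hw'c : HasCompactSupport w' := b.hasCompactSupport.mul_right
  have hw'0 : ∀ y, 0 ≤ w' y := fun y ↦ mul_nonneg (hχ0 y) (hw0 y)
  have hsupp : tsupport w' ⊆ tsupport w := tsupport_mul_subset_right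
  have h0' : (0 : E) ∉ tsupport w' := fun h ↦ h0 (hsupp h)
  have hu' : ∀ y ∈ tsupport w', ContDiffAt ℝ 1 u y := fun y hy ↦ hu y (hsupp hy)
  have key := hardy_weighted_goodDeriv_le h3 hw'C hw'c hw'0 h0' hu'
  -- the three integrands are unchanged
  have hw'z : ∀ y ∉ tsupport w, w' y = 0 := fun y hy ↦ by simp [hw', hwz y hy]
  have hDw'z : ∀ y ∉ tsupport w, fderiv ℝ w' y = 0 := fun y hy ↦
    fderiv_of_notMem_tsupport ℝ fun h ↦ hy (hsupp h)
  have hDw' : ∀ y, fderiv ℝ w' y y * u y ^ 2 = fderiv ℝ w y y * u y ^ 2 := by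
    intro y
    by_cases hyw : y ∈ tsupport w
    swap
    · simp [hDwz y hyw, hDw'z y hyw]
    rcases lt_or_ge (R : ℝ) ‖y‖ with hy | hy
    · simp [huR y hyw hy]
    · have hy1 : ‖y‖ < R + 1 := by linarith
      have hd : HasFDerivAt (fun z ↦ χ z * w z) (χ y • fderiv ℝ w y + w y • fderiv ℝ χ y) y :=
        (hχC.differentiable one_ne_zero y).hasFDerivAt.mul (hw.differentiable one_ne_zero y).hasFDerivAt
      rw [hw', hd.fderiv]
      simp [hDχ y hy1, hχ1 y hy1.le]
  have hI : (fun y ↦ w' y * u y ^ 2 / ‖y‖ ^ 2) = fun y ↦ w y * u y ^ 2 / ‖y‖ ^ 2 := by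
    funext y
    by_cases hyw : y ∈ tsupport w
    swap
    · simp [hwz y hyw, hw'z y hyw]
    rcases lt_or_ge (R : ℝ) ‖y‖ with hy | hy
    · simp [huR y hyw hy]
    · simp [hw', hχ1 y (by linarith)]
  have hA : (fun y ↦ fderiv ℝ w' y y * u y ^ 2 / ‖y‖ ^ 2) =
      fun y ↦ fderiv ℝ w y y * u y ^ 2 / ‖y‖ ^ 2 := by
    funext y; rw [hDw' y]
  have hJ : (fun y ↦ w' y * (u y + fderiv ℝ u y y) ^ 2 / ‖y‖ ^ 2) =
      fun y ↦ w y * (u y + fderiv ℝ u y y) ^ 2 / ‖y‖ ^ 2 := by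
    funext y
    by_cases hyw : y ∈ tsupport w
    swap
    · simp [hwz y hyw, hw'z y hyw]
    rcases lt_or_ge (R : ℝ) ‖y‖ with hy | hy
    · simp [huR y hyw hy, hDuR y hyw hy]
    · simp [hw', hχ1 y (by linarith)]
  rw [hI, hA, hJ] at key
  exact key

end Literature.Analysis.Calculus
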